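import Summits.CriticalPhenomena.CardyFormulaZ2.Theorems.CardyComplexConeEdgePrecompactVertexRelationPairSum
import Summits.CriticalPhenomena.CardyFormulaZ2.Theorems.CardyComplexConeEdgePrecompactVertexRelationSpliceLoop
import Summits.CriticalPhenomena.CardyFormulaZ2.Theorems.CardyComplexConeEdgePrecompactPassageAgree
import Summits.CriticalPhenomena.CardyFormulaZ2.Theorems.CardyComplexConeEdgePrecompactShiftCouplingLocalityReduction

/-!
# The `q = 1` half-Cauchy–Riemann vertex relation for the corner observable (`stub_vertexRelation`)
(line `qkz-strip-boundary-arm` of crux `CardyComplexCone.EdgePrecompact`, stmt-CriticalPhenomena-11387;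
closing file of the stub, Jordan-restricted form, `χ = +i`)

For the discretisation `E` of a Jordan Dobrushin domain `D` (`E.Ω = D.carrier`, `ℤ²`-admissible) and an
interior edge `e = {x, x + eᵢ}` of `Ω_δ` (in the edge set, no endpoint on the discrete arcs, both
adjacent faces inner), the spin-`1/3` corner observable `cornerObs` of the line's vocabulary
(`CardyComplexConeDefs.lean`; the `P_{1/2}`-expectation of the dart phase sum
`e^{−(i/3) W}` of the medial exploration path) satisfies, at the four corners `NW, NE, SE, SW` at `e`,
`E(NW) − E(SE) = i · (E(NE) − E(SW))` — Duminil-Copin–Smirnov, arXiv:1109.1549, Prop. 8.6 /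
Duminil-Copin, arXiv:1208.3787, Prop. 4, at `q = 1`, in the tree's conventions. (For arbitrary
admissible data the relation is FALSE: marked points on a hole of a multiply connected `Ω_δ`, exact
enumeration, evidence `vertexRelation_hole_cex.md` of the item; hence the Jordan restriction.)

Proof (edge-flip involution at `p = 1/2`):
* `bondPercolation_half_map_symmDiff`: `ω ↦ ω △ {e}` preserves `P_{1/2}` (a fair coin is invariant under
  negation; `Measure.infinitePi_map_pi`), so an integrable `Φ` with `Φ(ω △ {e}) = −Φ(ω)` integrates to `0`.
* `dartPhaseSum_eq_orbitSum`: the integrand of `cornerObs` at a coded corner `q` is the orbit phase sum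
  `∑_{j<N, orb j = q} λ^{turnCount j}`, `λ = e^{−iπ/6}`, over the cut orbit of the start corner
  (`medialExploration_eq_explorationList`, `passage_iff`, `winding_take_explorationList`).
* `dartPhaseSum_pair`: the defect `Φ = F(oX) − F(oY) − i(F(p₂) − F(p))` is odd under the involution:
  the pair identity `vertexRelation_pairSum` (`…VertexRelationPairSum.lean`, once/twice bookkeeping of
  `…VertexRelationOnceTwice.lean`, identities `2λ − λ̄ = i(λ² − 2)`, `λ − 2λ̄ = i(λ̄² − 2)` proved here
  from `sin (π/6) = 1/2`), fed with the planar input `spliceLoop_turning_eq`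
  (`…VertexRelationSpliceLoop.lean`: for Jordan data the loop spliced in at `e` turns by `4 · turnSign`,
  via `holeFree_innerFaces` and the tube lemma of `…VertexRelationChainWinding.lean`).
* `cornerObs_vertexRelation` integrates; `stub_vertexRelation` reads the crux's corner table for the two
  orientations of `e` (`p = (x, 3)` horizontal, `p = (x, 0)` vertical).
-/

namespace Summit.CriticalPhenomena.CardyFormulaZ2.Cruxes.EdgePrecompact.QkzStripBoundaryArm

open MeasureTheory Filter Set Metric
open scoped Topology BigOperators Pointwise
open Literature.Probability.LatticeModels Literature.Probability.Percolation
open Literature.Probability.RandomPlanarGeometry (DobrushinDomain)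
open Summit.CriticalPhenomena.CardyFormulaZ2.Theses.CardyComplexCone

/-! ## The edge-flip involution preserves `P_{1/2}` -/

/-- Toggling one pair is measurable. -/
theorem measurable_symmDiff_singleton (e : Sym2 (Site 2)) :
    Measurable fun ω : BondConfig (Site 2) => symmDiff ω {e} := by
  refine measurable_set_iff.2 fun a => ?_
  have : (fun ω : BondConfig (Site 2) => a ∈ symmDiff ω {e}) =
      fun ω => (a ∈ ω ∧ ¬ a = e) ∨ (a = e ∧ a ∉ ω) := by
    funext ω; simp [Set.mem_symmDiff]
  rw [this]
  exact ((measurable_set_mem a).and measurable_const).or (measurable_const.and (measurable_set_notMem a))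

/-- **Edge-flip invariance of bond percolation at `p = 1/2`.** For a lattice edge `e`, the involution
`ω ↦ ω △ {e}` preserves `P_{1/2}`: the coordinate at `e` is a fair coin, whose law is invariant under
negation, and all other coordinates are untouched (`Measure.infinitePi_map_pi`). -/
theorem bondPercolation_half_map_symmDiff {e : Sym2 (Site 2)} (he : e ∈ (zdGraph 2).edgeSet) :
    (bondPercolation (zdGraph 2) half).map (fun ω => symmDiff ω {e}) = bondPercolation (zdGraph 2) half := by
  set Ez := (zdGraph 2).edgeSet
  set ν : Sym2 (Site 2) → Measure Prop := fun i =>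
    unitInterval.toNNReal half • Measure.dirac (i ∈ Ez) + unitInterval.toNNReal (unitInterval.symm half) • Measure.dirac False
  set f : (i : Sym2 (Site 2)) → Prop → Prop := fun i P => (P ∧ ¬ i = e) ∨ (i = e ∧ ¬ P)
  have hsymm : unitInterval.symm half = half := by ext; simp [half]; norm_num
  have hν' : (fun i => (ν i).map (f i)) = ν := by
    funext i
    by_cases hi : i = e
    · subst hi
      have hf : f i = Not := funext fun P => propext (by simp [f])
      have hmem : (i ∈ Ez) = True := propext ⟨fun _ => trivial, fun _ => he⟩
      rw [hf]
      simp only [ν]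
      rw [Measure.map_add _ _ Measurable.of_discrete, Measure.map_smul, Measure.map_smul,
        Measure.map_dirac' Measurable.of_discrete, Measure.map_dirac' Measurable.of_discrete, hmem, hsymm,
        add_comm]
      congr 3
      · exact propext ⟨fun _ => trivial, fun _ h => h⟩
      · exact propext ⟨fun h => h trivial, fun h _ => h⟩
    · have hf : f i = id := funext fun P => propext (by simp [f, hi])
      rw [hf, Measure.map_id]
  have hcomm : (fun ω : BondConfig (Site 2) => symmDiff ω {e}) ∘ (fun q : Sym2 (Site 2) → Prop => {i | q i}) =
      (fun q : Sym2 (Site 2) → Prop => {i | q i}) ∘ (fun x i => f i (x i)) := by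
    funext q; ext i
    simp [f, Set.mem_symmDiff]
  have hmf : Measurable (fun (x : Sym2 (Site 2) → Prop) i => f i (x i)) :=
    measurable_pi_lambda _ fun i => (Measurable.of_discrete : Measurable (f i)).comp (measurable_pi_apply i)
  rw [bondPercolation, ProbabilityTheory.setBernoulli_eq_map, Measure.map_map (measurable_symmDiff_singleton e)
    measurable_setOf, hcomm, ← Measure.map_map measurable_setOf hmf,
    Measure.infinitePi_map_pi, hν']
  exact fun i => Measurable.of_discrete

/-! ## The phase `λ^m = exp (−iπm/6)` -/

/-- `λ^{m+n} = λ^m λ^n`. -/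
theorem twelfth_add (m n : ℤ) :
    Complex.exp (-(Real.pi / 6 * ((m + n : ℤ) : ℂ)) * Complex.I) =
      Complex.exp (-(Real.pi / 6 * (m : ℂ)) * Complex.I) * Complex.exp (-(Real.pi / 6 * (n : ℂ)) * Complex.I) := by
  rw [← Complex.exp_add]; congr 1; push_cast; ring

/-- `λ − λ̄ = −i` (`2 sin (π/6) = 1`). -/
theorem twelfth_one_sub :
    Complex.exp (-(Real.pi / 6 * ((1 : ℤ) : ℂ)) * Complex.I) - Complex.exp (-(Real.pi / 6 * ((-1 : ℤ) : ℂ)) * Complex.I) =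
      -Complex.I := by
  have h1 : -(Real.pi / 6 * ((1 : ℤ) : ℂ)) * Complex.I = ((-(Real.pi / 6) : ℝ) : ℂ) * Complex.I := by push_cast; ring
  have h2 : -(Real.pi / 6 * ((-1 : ℤ) : ℂ)) * Complex.I = (((Real.pi / 6) : ℝ) : ℂ) * Complex.I := by push_cast; ring
  rw [h1, h2, Complex.exp_mul_I, Complex.exp_mul_I, ← Complex.ofReal_cos, ← Complex.ofReal_sin, ← Complex.ofReal_cos,
    ← Complex.ofReal_sin, Real.cos_neg, Real.sin_neg, Real.sin_pi_div_six]
  push_cast; ring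

/-- The two identities of the per-pair algebra (`χ = +i`): `2λ − λ⁻¹ = i(λ² − 2)` and
`λ − 2λ⁻¹ = i(λ⁻² − 2)`, consequences of `λ − λ̄ = −i` and `λλ̄ = 1`. -/
theorem twelfth_identities :
    (2 * Complex.exp (-(Real.pi / 6 * ((1 : ℤ) : ℂ)) * Complex.I) - Complex.exp (-(Real.pi / 6 * ((-1 : ℤ) : ℂ)) * Complex.I) =
      Complex.I * (Complex.exp (-(Real.pi / 6 * ((2 : ℤ) : ℂ)) * Complex.I) - 2)) ∧
    (Complex.exp (-(Real.pi / 6 * ((1 : ℤ) : ℂ)) * Complex.I) - 2 * Complex.exp (-(Real.pi / 6 * ((-1 : ℤ) : ℂ)) * Complex.I) =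
      Complex.I * (Complex.exp (-(Real.pi / 6 * ((-2 : ℤ) : ℂ)) * Complex.I) - 2)) := by
  have e1 := twelfth_one_sub
  have e2 : Complex.exp (-(Real.pi / 6 * ((1 : ℤ) : ℂ)) * Complex.I) * Complex.exp (-(Real.pi / 6 * ((-1 : ℤ) : ℂ)) * Complex.I) = 1 := by
    rw [← twelfth_add]; simp
  have e3 : Complex.exp (-(Real.pi / 6 * ((2 : ℤ) : ℂ)) * Complex.I) =
      Complex.exp (-(Real.pi / 6 * ((1 : ℤ) : ℂ)) * Complex.I) * Complex.exp (-(Real.pi / 6 * ((1 : ℤ) : ℂ)) * Complex.I) := by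
    rw [← twelfth_add]; norm_num
  have e4 : Complex.exp (-(Real.pi / 6 * ((-2 : ℤ) : ℂ)) * Complex.I) =
      Complex.exp (-(Real.pi / 6 * ((-1 : ℤ) : ℂ)) * Complex.I) * Complex.exp (-(Real.pi / 6 * ((-1 : ℤ) : ℂ)) * Complex.I) := by
    rw [← twelfth_add]; norm_num
  set u := Complex.exp (-(Real.pi / 6 * ((1 : ℤ) : ℂ)) * Complex.I)
  set v := Complex.exp (-(Real.pi / 6 * ((-1 : ℤ) : ℂ)) * Complex.I)
  rw [e3, e4]
  constructor
  · linear_combination (1 - Complex.I * u) * e1 - Complex.I * e2 + u * Complex.I_mul_I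
  · linear_combination (1 + Complex.I * v) * e1 - Complex.I * e2 - v * Complex.I_mul_I

/-! ## The corner observable's integrand as an orbit phase sum -/

/-- **Dictionary.** For admissible data, the spin-`1/3` phase sum of the exploration path at the coded
corner `q` is the orbit phase sum `∑_{j < N, orb j = q} λ^{turnCount j}` over the cut orbit of the start
corner (exit time `N`): the path is the cut orbit, it traverses the dart of `q` at the times `j` with
`orb j = q`, and the winding of the polyline up to that dart is `(π/2) · turnCount j`. -/
theorem dartPhaseSum_eq_orbitSum {E : DiscreteDobrushin} (hE : E.IsZdAdmissible) (ω : BondConfig (Site 2))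
    (q : Site 2 × Fin 4) :
    dartPhaseSum (medialExploration E ω) E.δ (1 / 3) (q.1, cFace q) =
      ∑ j ∈ (Finset.range (DiscreteDobrushin.exitTime hE ω)).filter
          (fun j => cornerOrbit (E.bcBondConfig ω) (DiscreteDobrushin.startCorner hE) j = q),
        Complex.exp (-(Real.pi / 6 * ((turnCount (E.bcBondConfig ω) (DiscreteDobrushin.startCorner hE) j : ℤ) : ℂ)) *
          Complex.I) := by
  rw [DiscreteDobrushin.medialExploration_eq_explorationList hE ω, dartPhaseSum]
  simp only [cornerSource_cFace, cornerTarget_cFace, length_explorationList']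
  have hfilt : (Finset.range (DiscreteDobrushin.exitTime hE ω + 1)).filter (fun k =>
      (explorationList (E.bcBondConfig ω) (DiscreteDobrushin.startCorner hE) (DiscreteDobrushin.exitTime hE ω))[k]? =
          some (cSrc q) ∧
        (explorationList (E.bcBondConfig ω) (DiscreteDobrushin.startCorner hE) (DiscreteDobrushin.exitTime hE ω))[k + 1]? =
          some (cTgt q)) =
      (Finset.range (DiscreteDobrushin.exitTime hE ω)).filter
        (fun j => cornerOrbit (E.bcBondConfig ω) (DiscreteDobrushin.startCorner hE) j = q) := by
    ext k
    simp only [Finset.mem_filter, Finset.mem_range, passage_iff]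
    exact ⟨fun h => h.2, fun h => ⟨Nat.lt_succ_of_lt h.1, h⟩⟩
  rw [hfilt]
  refine Finset.sum_congr rfl fun k hk => ?_
  have hkN : k < DiscreteDobrushin.exitTime hE ω := Finset.mem_range.1 (Finset.mem_filter.1 hk).1
  rw [winding_take_explorationList hE.delta_pos.ne' _ _ hkN, sum_turnOf_eq, turnCount]
  congr 1
  push_cast
  ring

/-! ## Interior edges: all faces at the endpoints are inner -/

/-- Around a site off the discrete arcs of admissible data, one inner face forces all four faces to be
inner (otherwise some edge at the site would be a face-boundary edge, putting it on `zdBoundary ⊆ A ∪ B`). -/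
theorem forall_isInnerFace_of_not_mem_arcs {E : DiscreteDobrushin} (hE : E.IsZdAdmissible) {v : Site 2}
    (hvA : v ∉ E.zdArcA) (hvB : v ∉ E.zdArcB) {j₀ : Fin 4} (hj₀ : E.IsInnerFace (faceAt v j₀)) :
    ∀ j, E.IsInnerFace (faceAt v j) := by
  have hvb : v ∉ E.zdBoundary := fun h => by
    rcases hE.zdBoundary_subset h with h | h
    · exact hvA h
    · exact hvB h
  have key : ∀ k, E.IsInnerFace (faceAt v k) → E.IsInnerFace (faceAt v (k + 1)) := by
    intro k hk
    by_contra hk1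
    have hIn : E.IsInEdge v (k + 1) := ⟨by rw [fin4_add_one_add_three]; exact hk, hk1⟩
    exact hvb hIn.isFaceBoundaryEdge.mem_zdBoundary.1
  have hall : ∀ a b : Fin 4, b = a ∨ b = a + 1 ∨ b = a + 1 + 1 ∨ b = a + 1 + 1 + 1 := by decide
  intro j
  rcases hall j₀ j with rfl | rfl | rfl | rfl
  · exact hj₀
  · exact key _ hj₀
  · exact key _ (key _ hj₀)
  · exact key _ (key _ (key _ hj₀))

/-! ## The pair identity for the exploration paths, and the relation in expectation -/

/-- **Pointwise pair identity.** Jordan data, admissible; `e = cTgt p` an edge of `Ω_δ` off the arcs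
whose two faces are inner. For every configuration `ω`, the defect
`Φ(ω) = F(oX) − F(oY) − i (F(p₂) − F(p))` of the vertex relation (spin-`1/3` phase sums of the exploration
path at the four corners at `e`) satisfies `Φ(ω △ {e}) = −Φ(ω)`. -/
theorem dartPhaseSum_pair (D : DobrushinDomain) {E : DiscreteDobrushin} (hΩ : E.Ω = D.carrier)
    (hE : E.IsZdAdmissible) {p : Site 2 × Fin 4} (he : cTgt p ∈ (discreteDomainGraph E.Ω E.δ).edgeSet)
    (hAB : ∀ y ∈ cTgt p, y ∉ E.zdArcA ∧ y ∉ E.zdArcB) (hin₁ : E.IsInnerFace (cFace p))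
    (hin₂ : E.IsInnerFace (faceAt p.1 (p.2 + 1))) (ω : BondConfig (Site 2)) :
    (dartPhaseSum (medialExploration E (symmDiff ω {cTgt p})) E.δ (1 / 3) (p.1, cFace (p.1, p.2 + 1)) -
        dartPhaseSum (medialExploration E (symmDiff ω {cTgt p})) E.δ (1 / 3)
          (p.1 + cornerUnit (p.2 + 1), cFace (p.1 + cornerUnit (p.2 + 1), p.2 + 3)) -
        Complex.I * (dartPhaseSum (medialExploration E (symmDiff ω {cTgt p})) E.δ (1 / 3)
            ((cornerPartner p).1, cFace (cornerPartner p)) -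
          dartPhaseSum (medialExploration E (symmDiff ω {cTgt p})) E.δ (1 / 3) (p.1, cFace p))) =
      -(dartPhaseSum (medialExploration E ω) E.δ (1 / 3) (p.1, cFace (p.1, p.2 + 1)) -
        dartPhaseSum (medialExploration E ω) E.δ (1 / 3)
          (p.1 + cornerUnit (p.2 + 1), cFace (p.1 + cornerUnit (p.2 + 1), p.2 + 3)) -
        Complex.I * (dartPhaseSum (medialExploration E ω) E.δ (1 / 3) ((cornerPartner p).1, cFace (cornerPartner p)) -
          dartPhaseSum (medialExploration E ω) E.δ (1 / 3) (p.1, cFace p))) := by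
  -- all faces at both endpoints are inner
  have hxA := (hAB p.1 (Sym2.mem_mk_left _ _)).1
  have hxB := (hAB p.1 (Sym2.mem_mk_left _ _)).2
  have hyA := (hAB (p.1 + cornerUnit (p.2 + 1)) (Sym2.mem_mk_right _ _)).1
  have hyB := (hAB (p.1 + cornerUnit (p.2 + 1)) (Sym2.mem_mk_right _ _)).2
  have hx : ∀ j, E.IsInnerFace (faceAt p.1 j) := forall_isInnerFace_of_not_mem_arcs hE hxA hxB (j₀ := p.2) hin₁
  have hin₂' : E.IsInnerFace (faceAt (p.1 + cornerUnit (p.2 + 1)) (p.2 + 2)) := by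
    rw [← fin4_add_one_add_one, faceAt_add_unit_succ]; exact hin₂
  have hy : ∀ j, E.IsInnerFace (faceAt (p.1 + cornerUnit (p.2 + 1)) j) :=
    forall_isInnerFace_of_not_mem_arcs hE hyA hyB hin₂'
  -- the completions agree off `e` and differ at `e`
  have hbc : ∀ ω₁ : BondConfig (Site 2), cTgt p ∈ E.bcBondConfig ω₁ ↔ cTgt p ∈ ω₁ := by
    intro ω₁
    rw [DiscreteDobrushin.mem_bcBondConfig_iff]
    constructor
    · rintro ⟨-, h | ⟨h, -⟩⟩
      · exact absurd (h p.1 (Sym2.mem_mk_left _ _)) hxA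
      · exact h
    · intro h
      exact ⟨he, Or.inr ⟨h, fun y hy' => (hAB y hy').2⟩⟩
  have hagree : ∀ e', e' ≠ cTgt p → (e' ∈ E.bcBondConfig (symmDiff ω {cTgt p}) ↔ e' ∈ E.bcBondConfig ω) := by
    intro e' he'
    simp only [DiscreteDobrushin.mem_bcBondConfig_iff, Set.mem_symmDiff, Set.mem_singleton_iff, he', not_false_eq_true,
      and_true, false_and, or_false]
  have hdiff : ¬ (cTgt p ∈ E.bcBondConfig (symmDiff ω {cTgt p}) ↔ cTgt p ∈ E.bcBondConfig ω) := by
    rw [hbc, hbc, Set.mem_symmDiff]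
    simp
  -- the orbit form of the eight phase sums
  rw [show (p.1, cFace (p.1, p.2 + 1)) = ((p.1, p.2 + 1).1, cFace (p.1, p.2 + 1)) from rfl,
    show (p.1 + cornerUnit (p.2 + 1), cFace (p.1 + cornerUnit (p.2 + 1), p.2 + 3)) =
      ((p.1 + cornerUnit (p.2 + 1), p.2 + 3).1, cFace (p.1 + cornerUnit (p.2 + 1), p.2 + 3)) from rfl]
  rw [dartPhaseSum_eq_orbitSum hE (symmDiff ω {cTgt p}) (p.1, p.2 + 1),
    dartPhaseSum_eq_orbitSum hE (symmDiff ω {cTgt p}) (p.1 + cornerUnit (p.2 + 1), p.2 + 3),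
    dartPhaseSum_eq_orbitSum hE (symmDiff ω {cTgt p}) (cornerPartner p), dartPhaseSum_eq_orbitSum hE (symmDiff ω {cTgt p}) p,
    dartPhaseSum_eq_orbitSum hE ω (p.1, p.2 + 1), dartPhaseSum_eq_orbitSum hE ω (p.1 + cornerUnit (p.2 + 1), p.2 + 3),
    dartPhaseSum_eq_orbitSum hE ω (cornerPartner p), dartPhaseSum_eq_orbitSum hE ω p]
  have key := vertexRelation_pairSum (fun m : ℤ => Complex.exp (-(Real.pi / 6 * (m : ℂ)) * Complex.I)) twelfth_add
    twelfth_identities.1 twelfth_identities.2 E hE ω (symmDiff ω {cTgt p}) (DiscreteDobrushin.startCorner hE) p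
    (DiscreteDobrushin.exitTime hE ω) (DiscreteDobrushin.exitTime hE (symmDiff ω {cTgt p}))
    (DiscreteDobrushin.isStartCorner_startCorner hE) hagree hdiff hx hy
    (DiscreteDobrushin.not_isInnerFace_exitTime hE ω) (fun k hk => DiscreteDobrushin.isInnerFace_of_lt_exitTime hE ω hk)
    (DiscreteDobrushin.not_isInnerFace_exitTime hE _) (fun k hk => DiscreteDobrushin.isInnerFace_of_lt_exitTime hE _ hk)
    (fun ω₁ p₁ N₁ i₁ Q _ a b c d e f g h i =>
      spliceLoop_turning_eq D E hΩ hE ω₁ (DiscreteDobrushin.startCorner hE) p₁ N₁ i₁ Q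
        (DiscreteDobrushin.isStartCorner_startCorner hE) a b c d e f g h i)
  beta_reduce at key
  linear_combination key

/-- **The vertex relation for the corner observable** at the medial vertex `e = cTgt p` (Jordan data,
admissible, `e` an edge of `Ω_δ` off the arcs with both faces inner):
`E(oX) − E(oY) = i (E(p₂) − E(p))` for the two corners `oX = (p.1, p.2+1)`, `oY = (p.1 + u, p.2+3)`
leaving `e` and the two corners `p`, `p₂ = cornerPartner p` arriving at it. Proof: the defect `Φ` is
integrable, odd under the `P_{1/2}`-preserving involution `ω ↦ ω △ {e}` (`dartPhaseSum_pair`,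
`bondPercolation_half_map_symmDiff`), hence has integral zero. -/
theorem cornerObs_vertexRelation (D : DobrushinDomain) {E : DiscreteDobrushin} (hΩ : E.Ω = D.carrier)
    (hE : E.IsZdAdmissible) {p : Site 2 × Fin 4} (he : cTgt p ∈ (discreteDomainGraph E.Ω E.δ).edgeSet)
    (hAB : ∀ y ∈ cTgt p, y ∉ E.zdArcA ∧ y ∉ E.zdArcB) (hin₁ : E.IsInnerFace (cFace p))
    (hin₂ : E.IsInnerFace (faceAt p.1 (p.2 + 1))) :
    cornerObs E E.δ p.1 (cFace (p.1, p.2 + 1)) -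
        cornerObs E E.δ (p.1 + cornerUnit (p.2 + 1)) (cFace (p.1 + cornerUnit (p.2 + 1), p.2 + 3)) =
      Complex.I * (cornerObs E E.δ (cornerPartner p).1 (cFace (cornerPartner p)) - cornerObs E E.δ p.1 (cFace p)) := by
  simp only [cornerObs_eq_integral_dartPhaseSum]
  set P := bondPercolation (zdGraph 2) half with hP
  set Φ : BondConfig (Site 2) → ℂ := fun ω =>
    dartPhaseSum (medialExploration E ω) E.δ (1 / 3) (p.1, cFace (p.1, p.2 + 1)) -
      dartPhaseSum (medialExploration E ω) E.δ (1 / 3) (p.1 + cornerUnit (p.2 + 1), cFace (p.1 + cornerUnit (p.2 + 1), p.2 + 3)) -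
      Complex.I * (dartPhaseSum (medialExploration E ω) E.δ (1 / 3) ((cornerPartner p).1, cFace (cornerPartner p)) -
        dartPhaseSum (medialExploration E ω) E.δ (1 / 3) (p.1, cFace p)) with hΦ
  have hint : ∀ c : Site 2 × Site 2, Integrable (fun ω => dartPhaseSum (medialExploration E ω) E.δ (1 / 3) c) P :=
    fun c => integrable_dartPhaseSum_medialExploration hE E.δ (1 / 3) c
  have hΦint : Integrable Φ P := ((hint _).sub (hint _)).sub (((hint _).sub (hint _)).const_mul Complex.I)
  have hτ : ∀ ω, Φ (symmDiff ω {cTgt p}) = -Φ ω := fun ω => dartPhaseSum_pair D hΩ hE he hAB hin₁ hin₂ ω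
  have hmap : P.map (fun ω => symmDiff ω {cTgt p}) = P := bondPercolation_half_map_symmDiff (cTgt_mem_edgeSet p)
  have hzero : ∫ ω, Φ ω ∂P = 0 := by
    have h1 : ∫ ω, Φ ω ∂P = ∫ ω, Φ (symmDiff ω {cTgt p}) ∂P := by
      conv_lhs => rw [← hmap]
      exact integral_map (measurable_symmDiff_singleton _).aemeasurable (by rw [hmap]; exact hΦint.aestronglyMeasurable)
    rw [show (fun ω => Φ (symmDiff ω {cTgt p})) = fun ω => -Φ ω from funext hτ, integral_neg] at h1
    linear_combination (1 / 2 : ℂ) * h1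
  have hexp : ∫ ω, Φ ω ∂P =
      (∫ ω, dartPhaseSum (medialExploration E ω) E.δ (1 / 3) (p.1, cFace (p.1, p.2 + 1)) ∂P) -
        (∫ ω, dartPhaseSum (medialExploration E ω) E.δ (1 / 3)
          (p.1 + cornerUnit (p.2 + 1), cFace (p.1 + cornerUnit (p.2 + 1), p.2 + 3)) ∂P) -
        Complex.I * ((∫ ω, dartPhaseSum (medialExploration E ω) E.δ (1 / 3) ((cornerPartner p).1, cFace (cornerPartner p)) ∂P) -
          (∫ ω, dartPhaseSum (medialExploration E ω) E.δ (1 / 3) (p.1, cFace p) ∂P)) := by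
    have i1 := hint (p.1, cFace (p.1, p.2 + 1))
    have i2 := hint (p.1 + cornerUnit (p.2 + 1), cFace (p.1 + cornerUnit (p.2 + 1), p.2 + 3))
    have i3 := hint ((cornerPartner p).1, cFace (cornerPartner p))
    have i4 := hint (p.1, cFace p)
    have i12 : Integrable (fun ω => dartPhaseSum (medialExploration E ω) E.δ (1 / 3) (p.1, cFace (p.1, p.2 + 1)) -
        dartPhaseSum (medialExploration E ω) E.δ (1 / 3)
          (p.1 + cornerUnit (p.2 + 1), cFace (p.1 + cornerUnit (p.2 + 1), p.2 + 3))) P := i1.sub i2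
    have i34 : Integrable (fun ω => Complex.I *
        (dartPhaseSum (medialExploration E ω) E.δ (1 / 3) ((cornerPartner p).1, cFace (cornerPartner p)) -
          dartPhaseSum (medialExploration E ω) E.δ (1 / 3) (p.1, cFace p))) P := (i3.sub i4).const_mul Complex.I
    rw [hΦ]
    beta_reduce
    rw [integral_sub i12 i34, integral_sub i1 i2, integral_const_mul, integral_sub i3 i4]
  rw [hexp] at hzero
  linear_combination hzero

/-! ## The stub -/

/-- **The `q = 1` half-Cauchy–Riemann vertex relation** (registered stub `stub_vertexRelation` of the
line `qkz-strip-boundary-arm` of crux `EdgePrecompact`, stmt-CriticalPhenomena-11387, Jordan-restricted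
form; Duminil-Copin–Smirnov 2012, Prop. 8.6 / Duminil-Copin 2012, Prop. 4 at `q = 1`, spin `1/3`), with
`χ = +i`: for the discretisation `E` of a Jordan Dobrushin domain, admissible, and an interior edge
`e = {x, x + eᵢ}` of `Ω_δ` (off the arcs, both faces inner), the spin-`1/3` corner observable at the four
corners `NW, NE, SE, SW` at `e` satisfies `E(NW) − E(SE) = i (E(NE) − E(SW))`. The unrestricted form
(all admissible `E`) is false on holed domains (evidence `vertexRelation_hole_cex.md`). -/
theorem stub_vertexRelation : ∃ χ : ℂ, (χ = Complex.I ∨ χ = -Complex.I) ∧ ∀ (D : DobrushinDomain) (E : DiscreteDobrushin), E.Ω = D.carrier → E.IsZdAdmissible → ∀ (x : Site 2) (i : Fin 2), (s(x, x + Pi.single i 1) ∈ (discreteDomainGraph E.Ω E.δ).edgeSet ∧ ∀ y ∈ s(x, x + Pi.single i 1), y ∉ E.zdArcA ∧ y ∉ E.zdArcB) → (∀ f : Site 2, IsCorner x f → IsCorner (x + Pi.single i 1) f → E.IsInnerFace f) → let c : Fin 4 → Site 2 × Site 2 := if i = 0 then ![(x, x), (x + Pi.single 0 1, x), (x + Pi.single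 0 1, x - Pi.single 1 1), (x, x - Pi.single 1 1)] else ![(x + Pi.single 1 1, x - Pi.single 0 1), (x + Pi.single 1 1, x), (x, x), (x, x - Pi.single 0 1)]; cornerObs E E.δ (c 0).1 (c 0).2 - cornerObs E E.δ (c 2).1 (c 2).2 = χ * (cornerObs E E.δ (c 1).1 (c 1).2 - cornerObs E E.δ (c 3).1 (c 3).2) := by
  refine ⟨Complex.I, Or.inl rfl, ?_⟩
  intro D E hΩ hE x i he hfaces
  obtain ⟨he, hAB⟩ := he
  fin_cases i
  · -- horizontal edge `{x, x + e₀}`: `p = (x, 3)`; table `NW, NE, SE, SW = oX, p₂, oY, p`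
    have hT : cTgt ((x, 3) : Site 2 × Fin 4) = s(x, x + Pi.single 0 1) := by
      show s(x, x + cornerUnit (3 + 1)) = _; rw [show (3 : Fin 4) + 1 = 0 by decide]; rfl
    have key := cornerObs_vertexRelation D hΩ hE (p := (x, 3)) (by rw [hT]; exact he) (by rw [hT]; exact hAB)
      (hfaces _ (isCorner_faceAt x 3) ((isCorner_add_faceAt_iff x 0 3).2 (Or.inr (by decide))))
      (by
        have := hfaces _ (isCorner_faceAt x 0) ((isCorner_add_faceAt_iff x 0 0).2 (Or.inl rfl))
        rwa [show (3 : Fin 4) + 1 = 0 by decide])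
    have e1 : cFace ((x, (3 : Fin 4) + 1) : Site 2 × Fin 4) = x := by
      rw [show (3 : Fin 4) + 1 = 0 by decide]; simp [cFace, faceAt, cornerOff]
    have e2 : cornerUnit ((3 : Fin 4) + 1) = Pi.single 0 1 := by rw [show (3 : Fin 4) + 1 = 0 by decide]; rfl
    have e3 : cFace ((x + Pi.single 0 1, (3 : Fin 4) + 3) : Site 2 × Fin 4) = x - Pi.single 1 1 := by
      rw [show (3 : Fin 4) + 3 = 2 by decide]
      simp only [cFace, faceAt, cornerOff]; abel
    have e4 : cornerPartner ((x, 3) : Site 2 × Fin 4) = (x + Pi.single 0 1, 1) := by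
      show (x + cornerUnit (3 + 1), (3 : Fin 4) + 2) = _
      rw [show (3 : Fin 4) + 1 = 0 by decide, show (3 : Fin 4) + 2 = 1 by decide]; rfl
    have e5 : cFace ((x + Pi.single 0 1, 1) : Site 2 × Fin 4) = x := by
      simp only [cFace, faceAt, cornerOff]; abel
    have e6 : cFace ((x, 3) : Site 2 × Fin 4) = x - Pi.single 1 1 := by simp [cFace, faceAt, cornerOff]
    simp only [e1, e2, e3, e4, e5, e6] at key
    intro c
    show cornerObs E E.δ x x - cornerObs E E.δ (x + Pi.single 0 1) (x - Pi.single 1 1) =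
      Complex.I * (cornerObs E E.δ (x + Pi.single 0 1) x - cornerObs E E.δ x (x - Pi.single 1 1))
    exact key
  · -- vertical edge `{x, x + e₁}`: `p = (x, 0)`; table `NW, NE, SE, SW = p₂, oY, p, oX`
    have hT : cTgt ((x, 0) : Site 2 × Fin 4) = s(x, x + Pi.single 1 1) := rfl
    have key := cornerObs_vertexRelation D hΩ hE (p := (x, 0)) (by rw [hT]; exact he) (by rw [hT]; exact hAB)
      (hfaces _ (isCorner_faceAt x 0) ((isCorner_add_faceAt_iff x 1 0).2 (Or.inr (by decide))))
      (hfaces _ (isCorner_faceAt x _) ((isCorner_add_faceAt_iff x 1 _).2 (Or.inl rfl)))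
    have e1 : cFace ((x, (0 : Fin 4) + 1) : Site 2 × Fin 4) = x - Pi.single 0 1 := by
      rw [show (0 : Fin 4) + 1 = 1 by decide]; simp [cFace, faceAt, cornerOff]
    have e2 : cornerUnit ((0 : Fin 4) + 1) = Pi.single 1 1 := rfl
    have e3 : cFace ((x + Pi.single 1 1, (0 : Fin 4) + 3) : Site 2 × Fin 4) = x := by
      rw [show (0 : Fin 4) + 3 = 3 by decide]
      simp only [cFace, faceAt, cornerOff]; abel
    have e4 : cornerPartner ((x, 0) : Site 2 × Fin 4) = (x + Pi.single 1 1, 2) := rfl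
    have e5 : cFace ((x + Pi.single 1 1, 2) : Site 2 × Fin 4) = x - Pi.single 0 1 := by
      simp only [cFace, faceAt, cornerOff]; abel
    have e6 : cFace ((x, 0) : Site 2 × Fin 4) = x := by simp [cFace, faceAt, cornerOff]
    simp only [e1, e2, e3, e4, e5, e6] at key
    intro c
    show cornerObs E E.δ (x + Pi.single 1 1) (x - Pi.single 0 1) - cornerObs E E.δ x x =
      Complex.I * (cornerObs E E.δ (x + Pi.single 1 1) x - cornerObs E E.δ x (x - Pi.single 0 1))
    linear_combination Complex.I * key +
      (cornerObs E E.δ (x + Pi.single 1 1) (x - Pi.single 0 1) - cornerObs E E.δ x x) * Complex.I_mul_I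

end Summit.CriticalPhenomena.CardyFormulaZ2.Cruxes.EdgePrecompact.QkzStripBoundaryArm
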